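import Summits.AnomalousDissipation.AnomalousDissipation.Theses.TaylorCertificates
import Summits.AnomalousDissipation.AnomalousDissipation.Theorems.TaylorCertificatesKolmogorovFloorResponseDefs

noncomputable section

set_option linter.dupNamespace false

open Matrix Finset UnitAddTorus
open scoped BigOperators ComplexConjugate

/-! # SKELETON of line `Sketch` (digit-frame-closure) for crux stmt-AnomalousDissipation-15122

`not_kolmogorovFloor : ¬ KolmogorovFloor` is PROVED LOGIC from the seven stubs below:
FRAME · DET · LINE-ALGEBRA · LINE-BOUNDS · DICTIONARY ⟹ (ASSEMBLY, the lead's) `ResponseStatement`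
⟹ (CHEAP) `CheapStatesStatement` ⟹ (KILL) `¬ KolmogorovFloor`. -/

namespace Summit.AnomalousDissipation.AnomalousDissipation.Theorems.KolmogorovFloor.Response

open MeasureTheory
open scoped InnerProductSpace
open Literature.Analysis.FunctionSpaces Literature.Analysis.FluidPDE
open Summit.AnomalousDissipation.AnomalousDissipation.Theses.TaylorCertificates

/-- **STUB FRAME (S/M, integer arithmetic).** In the balanced-digit frame of level `L ≥ 1` every nonzero lattice
mode of the `L`-ball is non-resonant (`k·k < 2|k·ξ_L|`), off both inadmissible planes (`k·e_L ≠ 0 ≠ k·n_L`), and not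
nearly parallel to `ξ_L` (`9(k·k)² ≤ 4|k × ξ_L|²`, the side condition of DET); with the three frame sizes.
Paper: Ideas/digit-frame-closure.md "Lever" (balanced base-`B` numerals); brute force L ≤ 15: 0 failures. -/
theorem stub_frame : ∀ L : ℕ, 1 ≤ L →
    digitXi L ⬝ᵥ digitE L = 0 ∧
    (2 * (L : ℤ) + 1) ^ 6 ≤ digitXi L ⬝ᵥ digitXi L ∧ digitXi L ⬝ᵥ digitXi L ≤ 3 * (2 * (L : ℤ) + 1) ^ 6 ∧
    (2 * (L : ℤ) + 1) ^ 4 ≤ digitE L ⬝ᵥ digitE L ∧ digitE L ⬝ᵥ digitE L ≤ 3 * (2 * (L : ℤ) + 1) ^ 4 ∧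
    digitN L ⬝ᵥ digitN L = (digitXi L ⬝ᵥ digitXi L) * (digitE L ⬝ᵥ digitE L) ∧
    ∀ k : Fin 3 → ℤ, k ≠ 0 → k ⬝ᵥ k ≤ (L : ℤ) ^ 2 →
      k ⬝ᵥ k < 2 * |k ⬝ᵥ digitXi L| ∧ k ⬝ᵥ digitE L ≠ 0 ∧ k ⬝ᵥ digitN L ≠ 0 ∧
      9 * (k ⬝ᵥ k) ^ 2 ≤ 4 * ((k ⬝ᵥ k) * (digitXi L ⬝ᵥ digitXi L) - (k ⬝ᵥ digitXi L) ^ 2) := by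
  sorry

/-- **STUB DET (M, finite sums; DET′ of SketchIdeator15122k2 §4).** The sheet determinant
`G = Σ_{odd |j| ≤ 2J+1} 1/E_j` is negative and bounded away from zero for EVERY truncation:
`G ≤ −(K·X2 − s²)/(4 s² X2)`. Proof: the pair `j = ±1` gives `−2K/(4s²−K²) ≤ −K/(2s²)`; each pair `|j| ≥ 3`
gives `≤ 2/((j²−1) X2 (1−δ))`, `δ = 9K/(16 X2)`, and `Σ_{odd j≥3} 2/(j²−1) ≤ 1/2` telescopes; the side condition
`9K² ≤ 4(K X2 − s²)` absorbs the positive tail. -/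
theorem stub_det : ∀ (d : LineData) (J : ℕ), 0 < d.K → d.K < 2 * |d.s| → d.s ^ 2 ≤ d.K * d.X2 →
    16 * d.K ≤ d.X2 → 9 * d.K ^ 2 ≤ 4 * (d.K * d.X2 - d.s ^ 2) →
    d.G J ≤ -(((d.K * d.X2 - d.s ^ 2 : ℤ) : ℝ) / (4 * ((d.s : ℝ) ^ 2) * (d.X2 : ℝ))) := by
  sorry

/-- **STUB LINE-ALGEBRA (M, pure algebra).** The closed-form sequences are solenoidal and solve the linearised
steady Euler equations on the line EXACTLY at every site `m ≠ ±(2J+2)` (the three residual components vanish),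
and they are conjugate-symmetric under `(a,c,s,v,m) ↦ (−a,−c,−s, conj v, −m)`.
Proof: `Rx_m = (πa/N_m)(Λ_{m−1} − Λ_{m+1} − [m=0]σ K/… )` vanishes by the window structure of `Λ` and `λ₋ − λ₊ = σ`;
`a·Re + T·Rx + c·Rn = 2πaX2(y_{m−1}+y_{m+1}) − q N_m = 0` (transversality of `c_{m±1}`, force transversality,
Parseval identity `a²/e2 + s²/X2 + c²/n2 = K`); `c e2·Re − a n2·Rn = −πa (P_{m+1} − P_{m−1} − inc(m)) = 0`
(definition of `P`; at `m = 0` the CLOSURE `Σ_{even m'} inc(m') = (2X2 c e2/a)(λ₊G₊ + λ₋G₋) − ρ = 0`);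
the `2×2` system has determinant `−D ≠ 0`. Symmetry: termwise (`E, G` even/swap, `σ ↦ −conj σ`, `ρ ↦ conj ρ`). -/
theorem stub_lineAlgebra : ∀ (d : LineData) (F : LineForce) (J : ℕ),
    d.a ≠ 0 → d.c ≠ 0 → d.X2 ≠ 0 → d.e2 ≠ 0 → d.n2 ≠ 0 → d.D ≠ 0 → d.G J ≠ 0 →
    (∀ m : ℤ, m % 2 = 1 → d.E m ≠ 0) → (∀ m : ℤ, d.N m ≠ 0) →
    (d.a : ℂ) * F.ve + (d.s : ℂ) * F.vx + (d.c : ℂ) * F.vn = 0 →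
    (d.a : ℂ) ^ 2 / (d.e2 : ℂ) + (d.s : ℂ) ^ 2 / (d.X2 : ℂ) + (d.c : ℂ) ^ 2 / (d.n2 : ℂ) = (d.K : ℂ) →
    (∀ m : ℤ, (d.a : ℂ) * xC d F J m + (d.T m : ℂ) * yC d F J m + (d.c : ℂ) * zC d F J m = 0) ∧
    (∀ m : ℤ, |m| ≠ 2 * (J : ℤ) + 2 → ReC d F J m = 0 ∧ RxC d F J m = 0 ∧ RnC d F J m = 0) ∧
    (∀ m : ℤ, (m % 2 = 0 ∨ 2 * (J : ℤ) + 1 < |m|) → xC d F J m = 0 ∧ yC d F J m = 0 ∧ zC d F J m = 0) ∧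
    (∀ m : ℤ, let d' : LineData := ⟨-d.a, -d.c, -d.s, d.K, d.X2, d.e2, d.n2⟩
      let F' : LineForce := ⟨starRingEnd ℂ F.ve, starRingEnd ℂ F.vx, starRingEnd ℂ F.vn⟩
      xC d' F' J m = starRingEnd ℂ (xC d F J (-m)) ∧ yC d' F' J m = starRingEnd ℂ (yC d F J (-m)) ∧
      zC d' F' J m = starRingEnd ℂ (zC d F J (-m))) := by
  sorry

/-- **STUB LINE-BOUNDS (M, finite-sum inequalities).** With one size parameter `Λ ≥ 1` dominating the seven
integers and `1/|G|`, and `Φ` dominating the three force components: `|x_m|, |y_m|, |z_m| ≤ 100 Λ⁷ Φ/|m|`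
(`|λ±| ≤ 2Λ⁴Φ`, `|y_m| ≤ 8Λ⁴Φ/m²`, `|P_m| ≤ 40Λ⁷Φ/|m|` by `Σ_{m'>m} 1/m'² ≤ 1/m`, `|T_m y_m| ≤ 16Λ⁵Φ/|m|`),
the edge residual components are `≤ 1000 Λ⁸ Φ/(2J+1)`, and the three window sums. -/
theorem stub_lineBounds : ∀ (d : LineData) (F : LineForce) (J : ℕ) (Λ Φ : ℝ), 1 ≤ Λ → 0 ≤ Φ →
    1 ≤ |d.a| → 1 ≤ |d.c| → 1 ≤ d.K → 1 ≤ d.X2 → 1 ≤ d.e2 → 1 ≤ d.n2 →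
    (|d.a| : ℝ) ≤ Λ → (|d.c| : ℝ) ≤ Λ → (|d.s| : ℝ) ≤ Λ → (d.K : ℝ) ≤ Λ → (d.X2 : ℝ) ≤ Λ →
    (d.e2 : ℝ) ≤ Λ → (d.n2 : ℝ) ≤ Λ → Λ⁻¹ ≤ |d.G J| →
    (∀ m : ℤ, m % 2 = 1 → d.E m ≠ 0) → (∀ m : ℤ, 3 ≤ |m| → m ^ 2 * d.X2 ≤ 4 * d.E m) →
    (∀ m : ℤ, 1 ≤ d.N m) → (∀ m : ℤ, 2 ≤ |m| → m ^ 2 * d.X2 ≤ 4 * d.N m) →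
    ‖F.ve‖ ≤ Φ → ‖F.vx‖ ≤ Φ → ‖F.vn‖ ≤ Φ →
    (∀ m : ℤ, ‖xC d F J m‖ ≤ 100 * Λ ^ 7 * Φ / |(m : ℝ)| ∧ ‖yC d F J m‖ ≤ 100 * Λ ^ 7 * Φ / |(m : ℝ)| ∧
      ‖zC d F J m‖ ≤ 100 * Λ ^ 7 * Φ / |(m : ℝ)|) ∧
    (∀ m : ℤ, |m| = 2 * (J : ℤ) + 2 →
      ‖ReC d F J m‖ + ‖RxC d F J m‖ + ‖RnC d F J m‖ ≤ 1000 * Λ ^ 8 * Φ / (2 * (J : ℝ) + 1)) ∧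
    (∑ m ∈ oddWindow J, (1 : ℝ) / |(m : ℝ)| ≤ 2 * (1 + Real.log (2 * (J : ℝ) + 1))) ∧
    (∑ m ∈ oddWindow J, (1 : ℝ) / (m : ℝ) ^ 2 ≤ 4) ∧ ((oddWindow J).card = 2 * J + 2) := by
  sorry

/-- **STUB DICTIONARY (M/L, trig-poly Fourier calculus over `Torus.realTrigPoly` / `convectionCoeff`).**
(D1) the integer-amplitude shear `U = sin(2πξ·x)e` (`ξ ⊥ e`, `ξ ≠ 0`, `ξ` in the synthesis ball): smooth, solenoidal,
mean-zero, an exact steady Euler state, with its coefficients, energy `e·e/2` and enstrophy `2π² (ξ·ξ)(e·e)`;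
(D2) the Fourier side of `(U·∇)b + (b·∇)U` for `b = realTrigPoly (freqBall R) C` is `linOp ξ e C`
(`mFourierCoeff_convect_realTrigPoly` with `Û(±ξ) = ∓(i/2)e`);
(D3) the beat-dual pairing bound: against a band-limited solenoidal mean-zero multiplier of slope `≤ M`, a smooth
field pairs to at most `M Σ_{0<|κ|≤N} ‖r̂(κ) − q_κ κ‖/|κ|` for ANY scalars `q` (gradients are invisible);
(D4) self-advection of a solenoidal trigonometric polynomial pairs to at most `2π M (Σ‖C‖)²`
(`\\widehat{(b·∇)b}(κ) = 2πi Σ_{l+m=κ} (C(l)·κ) C(m)` by solenoidality). -/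
theorem stub_dictionary :
    (∀ (R : ℕ) (ξ e : Fin 3 → ℤ), ξ ≠ 0 → ξ ⬝ᵥ e = 0 → ξ ∈ Torus.freqBall R →
      Torus.IsSmooth (shearField R ξ e) ∧ Torus.IsDivFree (shearField R ξ e) ∧
      Torus.HasZeroMean (shearField R ξ e) ∧ (∀ x, Torus.convect (shearField R ξ e) (shearField R ξ e) x = 0) ∧
      (∀ κ, mFourierCoeff (EuclideanSpace.complexify ∘ shearField R ξ e) κ = shearCoeff ξ e κ) ∧
      (∫ x, ‖shearField R ξ e x‖ ^ 2) = ((e ⬝ᵥ e : ℤ) : ℝ) / 2 ∧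
      (Torus.eGradNormSq (shearField R ξ e)).toReal = 2 * Real.pi ^ 2 * ((ξ ⬝ᵥ ξ : ℤ) : ℝ) * ((e ⬝ᵥ e : ℤ) : ℝ)) ∧
    (∀ (R : ℕ) (ξ e : Fin 3 → ℤ) (C : (Fin 3 → ℤ) → EuclideanSpace ℂ (Fin 3)), ξ ⬝ᵥ e = 0 →
      ξ ∈ Torus.freqBall R → Torus.IsConjSymm C → (∀ κ, κ ∉ Torus.freqBall R → C κ = 0) →
      ∀ κ, mFourierCoeff (EuclideanSpace.complexify ∘ fun x =>
          Torus.convect (shearField R ξ e) (Torus.realTrigPoly (Torus.freqBall R) C) x +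
          Torus.convect (Torus.realTrigPoly (Torus.freqBall R) C) (shearField R ξ e) x) κ = linOp ξ e C κ) ∧
    (∀ (r W : UnitAddTorus (Fin 3) → EuclideanSpace ℝ (Fin 3)) (N : ℕ) (M : ℝ) (q : (Fin 3 → ℤ) → ℂ),
      Torus.IsSmooth r → Torus.IsSmooth W → Torus.IsDivFree W → Torus.HasZeroMean W →
      (∀ κ, (N : ℝ) ^ 2 < Torus.freqNormSq κ → mFourierCoeff (EuclideanSpace.complexify ∘ W) κ = 0) →
      (∀ κ, Real.sqrt (Torus.freqNormSq κ) * ‖mFourierCoeff (EuclideanSpace.complexify ∘ W) κ‖ ≤ M) →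
      |∫ x, ⟪r x, W x⟫_ℝ| ≤ M * ∑ κ ∈ (Torus.freqBall N).erase 0,
        ‖mFourierCoeff (EuclideanSpace.complexify ∘ r) κ - q κ • Torus.freqVec κ‖ / Real.sqrt (Torus.freqNormSq κ)) ∧
    (∀ (S : Finset (Fin 3 → ℤ)) (C : (Fin 3 → ℤ) → EuclideanSpace ℂ (Fin 3))
      (W : UnitAddTorus (Fin 3) → EuclideanSpace ℝ (Fin 3)) (N : ℕ) (M : ℝ),
      (∀ κ ∈ S, -κ ∈ S) → Torus.IsConjSymm C → (∀ κ ∈ S, ∑ i, (κ i : ℂ) * C κ i = 0) → 0 ≤ M →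
      Torus.IsSmooth W → Torus.IsDivFree W → Torus.HasZeroMean W →
      (∀ κ, (N : ℝ) ^ 2 < Torus.freqNormSq κ → mFourierCoeff (EuclideanSpace.complexify ∘ W) κ = 0) →
      (∀ κ, Real.sqrt (Torus.freqNormSq κ) * ‖mFourierCoeff (EuclideanSpace.complexify ∘ W) κ‖ ≤ M) →
      |∫ x, ⟪Torus.convect (Torus.realTrigPoly S C) (Torus.realTrigPoly S C) x, W x⟫_ℝ| ≤
        2 * Real.pi * M * (∑ κ ∈ S, ‖C κ‖) ^ 2) := by
  sorry

/-- **STUB ASSEMBLY (L; the lead's).** The five stubs above give the quantitative response in the digit frame: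
`b := responseField R L ξ_L e_L f̂ J` on the lines of the forced modes of `P_L f`, `U := shearField R ξ_L e_L`,
`R` large; solenoidality / symmetry / exactness off the edges from LINE-ALGEBRA (hypotheses discharged by FRAME and
DET with `Λ = 4·(3L²)·(3B⁶)²`), sizes from LINE-BOUNDS summed over `≤ B³` lines, the Fourier side of the linear
defect from DICTIONARY (D2)+(D3) (only the two edge sites of each line survive), self-advection from (D4). -/
theorem stub_assembly :
    (∀ L : ℕ, 1 ≤ L →
      digitXi L ⬝ᵥ digitE L = 0 ∧
      (2 * (L : ℤ) + 1) ^ 6 ≤ digitXi L ⬝ᵥ digitXi L ∧ digitXi L ⬝ᵥ digitXi L ≤ 3 * (2 * (L : ℤ) + 1) ^ 6 ∧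
      (2 * (L : ℤ) + 1) ^ 4 ≤ digitE L ⬝ᵥ digitE L ∧ digitE L ⬝ᵥ digitE L ≤ 3 * (2 * (L : ℤ) + 1) ^ 4 ∧
      digitN L ⬝ᵥ digitN L = (digitXi L ⬝ᵥ digitXi L) * (digitE L ⬝ᵥ digitE L) ∧
      ∀ k : Fin 3 → ℤ, k ≠ 0 → k ⬝ᵥ k ≤ (L : ℤ) ^ 2 →
        k ⬝ᵥ k < 2 * |k ⬝ᵥ digitXi L| ∧ k ⬝ᵥ digitE L ≠ 0 ∧ k ⬝ᵥ digitN L ≠ 0 ∧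
        9 * (k ⬝ᵥ k) ^ 2 ≤ 4 * ((k ⬝ᵥ k) * (digitXi L ⬝ᵥ digitXi L) - (k ⬝ᵥ digitXi L) ^ 2)) →
    (∀ (d : LineData) (J : ℕ), 0 < d.K → d.K < 2 * |d.s| → d.s ^ 2 ≤ d.K * d.X2 →
      16 * d.K ≤ d.X2 → 9 * d.K ^ 2 ≤ 4 * (d.K * d.X2 - d.s ^ 2) →
      d.G J ≤ -(((d.K * d.X2 - d.s ^ 2 : ℤ) : ℝ) / (4 * ((d.s : ℝ) ^ 2) * (d.X2 : ℝ)))) →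
    (∀ (d : LineData) (F : LineForce) (J : ℕ),
      d.a ≠ 0 → d.c ≠ 0 → d.X2 ≠ 0 → d.e2 ≠ 0 → d.n2 ≠ 0 → d.D ≠ 0 → d.G J ≠ 0 →
      (∀ m : ℤ, m % 2 = 1 → d.E m ≠ 0) → (∀ m : ℤ, d.N m ≠ 0) →
      (d.a : ℂ) * F.ve + (d.s : ℂ) * F.vx + (d.c : ℂ) * F.vn = 0 →
      (d.a : ℂ) ^ 2 / (d.e2 : ℂ) + (d.s : ℂ) ^ 2 / (d.X2 : ℂ) + (d.c : ℂ) ^ 2 / (d.n2 : ℂ) = (d.K : ℂ) →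
      (∀ m : ℤ, (d.a : ℂ) * xC d F J m + (d.T m : ℂ) * yC d F J m + (d.c : ℂ) * zC d F J m = 0) ∧
      (∀ m : ℤ, |m| ≠ 2 * (J : ℤ) + 2 → ReC d F J m = 0 ∧ RxC d F J m = 0 ∧ RnC d F J m = 0) ∧
      (∀ m : ℤ, (m % 2 = 0 ∨ 2 * (J : ℤ) + 1 < |m|) → xC d F J m = 0 ∧ yC d F J m = 0 ∧ zC d F J m = 0) ∧
      (∀ m : ℤ, let d' : LineData := ⟨-d.a, -d.c, -d.s, d.K, d.X2, d.e2, d.n2⟩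
        let F' : LineForce := ⟨starRingEnd ℂ F.ve, starRingEnd ℂ F.vx, starRingEnd ℂ F.vn⟩
        xC d' F' J m = starRingEnd ℂ (xC d F J (-m)) ∧ yC d' F' J m = starRingEnd ℂ (yC d F J (-m)) ∧
        zC d' F' J m = starRingEnd ℂ (zC d F J (-m)))) →
    (∀ (d : LineData) (F : LineForce) (J : ℕ) (Λ Φ : ℝ), 1 ≤ Λ → 0 ≤ Φ →
      1 ≤ |d.a| → 1 ≤ |d.c| → 1 ≤ d.K → 1 ≤ d.X2 → 1 ≤ d.e2 → 1 ≤ d.n2 →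
      (|d.a| : ℝ) ≤ Λ → (|d.c| : ℝ) ≤ Λ → (|d.s| : ℝ) ≤ Λ → (d.K : ℝ) ≤ Λ → (d.X2 : ℝ) ≤ Λ →
      (d.e2 : ℝ) ≤ Λ → (d.n2 : ℝ) ≤ Λ → Λ⁻¹ ≤ |d.G J| →
      (∀ m : ℤ, m % 2 = 1 → d.E m ≠ 0) → (∀ m : ℤ, 3 ≤ |m| → m ^ 2 * d.X2 ≤ 4 * d.E m) →
      (∀ m : ℤ, 1 ≤ d.N m) → (∀ m : ℤ, 2 ≤ |m| → m ^ 2 * d.X2 ≤ 4 * d.N m) →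
      ‖F.ve‖ ≤ Φ → ‖F.vx‖ ≤ Φ → ‖F.vn‖ ≤ Φ →
      (∀ m : ℤ, ‖xC d F J m‖ ≤ 100 * Λ ^ 7 * Φ / |(m : ℝ)| ∧ ‖yC d F J m‖ ≤ 100 * Λ ^ 7 * Φ / |(m : ℝ)| ∧
        ‖zC d F J m‖ ≤ 100 * Λ ^ 7 * Φ / |(m : ℝ)|) ∧
      (∀ m : ℤ, |m| = 2 * (J : ℤ) + 2 →
        ‖ReC d F J m‖ + ‖RxC d F J m‖ + ‖RnC d F J m‖ ≤ 1000 * Λ ^ 8 * Φ / (2 * (J : ℝ) + 1)) ∧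
      (∑ m ∈ oddWindow J, (1 : ℝ) / |(m : ℝ)| ≤ 2 * (1 + Real.log (2 * (J : ℝ) + 1))) ∧
      (∑ m ∈ oddWindow J, (1 : ℝ) / (m : ℝ) ^ 2 ≤ 4) ∧ ((oddWindow J).card = 2 * J + 2)) →
    (((∀ (R : ℕ) (ξ e : Fin 3 → ℤ), ξ ≠ 0 → ξ ⬝ᵥ e = 0 → ξ ∈ Torus.freqBall R →
      Torus.IsSmooth (shearField R ξ e) ∧ Torus.IsDivFree (shearField R ξ e) ∧
      Torus.HasZeroMean (shearField R ξ e) ∧ (∀ x, Torus.convect (shearField R ξ e) (shearField R ξ e) x = 0) ∧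
      (∀ κ, mFourierCoeff (EuclideanSpace.complexify ∘ shearField R ξ e) κ = shearCoeff ξ e κ) ∧
      (∫ x, ‖shearField R ξ e x‖ ^ 2) = ((e ⬝ᵥ e : ℤ) : ℝ) / 2 ∧
      (Torus.eGradNormSq (shearField R ξ e)).toReal = 2 * Real.pi ^ 2 * ((ξ ⬝ᵥ ξ : ℤ) : ℝ) * ((e ⬝ᵥ e : ℤ) : ℝ)) ∧
    (∀ (R : ℕ) (ξ e : Fin 3 → ℤ) (C : (Fin 3 → ℤ) → EuclideanSpace ℂ (Fin 3)), ξ ⬝ᵥ e = 0 →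
      ξ ∈ Torus.freqBall R → Torus.IsConjSymm C → (∀ κ, κ ∉ Torus.freqBall R → C κ = 0) →
      ∀ κ, mFourierCoeff (EuclideanSpace.complexify ∘ fun x =>
          Torus.convect (shearField R ξ e) (Torus.realTrigPoly (Torus.freqBall R) C) x +
          Torus.convect (Torus.realTrigPoly (Torus.freqBall R) C) (shearField R ξ e) x) κ = linOp ξ e C κ) ∧
    (∀ (r W : UnitAddTorus (Fin 3) → EuclideanSpace ℝ (Fin 3)) (N : ℕ) (M : ℝ) (q : (Fin 3 → ℤ) → ℂ),
      Torus.IsSmooth r → Torus.IsSmooth W → Torus.IsDivFree W → Torus.HasZeroMean W →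
      (∀ κ, (N : ℝ) ^ 2 < Torus.freqNormSq κ → mFourierCoeff (EuclideanSpace.complexify ∘ W) κ = 0) →
      (∀ κ, Real.sqrt (Torus.freqNormSq κ) * ‖mFourierCoeff (EuclideanSpace.complexify ∘ W) κ‖ ≤ M) →
      |∫ x, ⟪r x, W x⟫_ℝ| ≤ M * ∑ κ ∈ (Torus.freqBall N).erase 0,
        ‖mFourierCoeff (EuclideanSpace.complexify ∘ r) κ - q κ • Torus.freqVec κ‖ / Real.sqrt (Torus.freqNormSq κ)) ∧
    (∀ (S : Finset (Fin 3 → ℤ)) (C : (Fin 3 → ℤ) → EuclideanSpace ℂ (Fin 3))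
      (W : UnitAddTorus (Fin 3) → EuclideanSpace ℝ (Fin 3)) (N : ℕ) (M : ℝ),
      (∀ κ ∈ S, -κ ∈ S) → Torus.IsConjSymm C → (∀ κ ∈ S, ∑ i, (κ i : ℂ) * C κ i = 0) → 0 ≤ M →
      Torus.IsSmooth W → Torus.IsDivFree W → Torus.HasZeroMean W →
      (∀ κ, (N : ℝ) ^ 2 < Torus.freqNormSq κ → mFourierCoeff (EuclideanSpace.complexify ∘ W) κ = 0) →
      (∀ κ, Real.sqrt (Torus.freqNormSq κ) * ‖mFourierCoeff (EuclideanSpace.complexify ∘ W) κ‖ ≤ M) →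
      |∫ x, ⟪Torus.convect (Torus.realTrigPoly S C) (Torus.realTrigPoly S C) x, W x⟫_ℝ| ≤
        2 * Real.pi * M * (∑ κ ∈ S, ‖C κ‖) ^ 2))) →
    ResponseStatement := by
  sorry

/-- **STUB CHEAP (M/L, rpow/log bookkeeping; the far field over `Negative/FarField.lean`).** The quantitative
response makes CHEAP states for every admissible force: per `η`, `L := ⌈η^{-σ}⌉` (`σ = 1/(100(p+12))`),
`J := ⌈η^{-1/2} B^{p}⌉`, `s := η^{-13/25}/√(X2 e2)`, `t := 1/s`, `a := s•U + t•b` (`farField_convect/defect`,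
`toReal_eGradNormSq_farField_le`, `integral_norm_sq_farField_le`, `slope_farField_le`, `work_farField`-type
bookkeeping); the smooth tail `Σ_{k∉ball L} ‖f̂(k)‖ = O(L^{-m})` (from `Torus.summable_norm_mFourierCoeff_of_isSmooth`
applied to `Δ^m f`) disposes of `f − P_L f` in the work and the defect; every `B^{O(p)} = η^{-O(σ p)}` loss sits
against a spare power `η^{1/25}`. -/
theorem stub_cheap : ResponseStatement → CheapStatesStatement := by
  sorry

/-- **STUB KILL (S if the farm serves `Negative/CheapStatesKill`, else M by adapting `floor_false_of_cheapStates`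
over the importable `cheap_base_kill`).** CHEAP states for every admissible force refute the crux by name:
`CheapStatesStatement ↔ CheapSteadyEulerStates` is `Iff.rfl` and
`kolmogorovFloor_false_of_CheapSteadyEulerStates` is in the tree. -/
theorem stub_kill : CheapStatesStatement → ¬ KolmogorovFloor := by
  sorry

/-- **The line concludes the NEGATION of the crux by name** (proved logic over the seven stubs). -/
theorem not_kolmogorovFloor : ¬ KolmogorovFloor :=
  stub_kill (stub_cheap (stub_assembly stub_frame stub_det stub_lineAlgebra stub_lineBounds stub_dictionary))

end Summit.AnomalousDissipation.AnomalousDissipation.Theorems.KolmogorovFloor.Response
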